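import Summits.AtomisticToContinuum.Crystallization.Theorems.PalmUnimodularRigidityMinimiserShellsResidual

/-!
# Crux `MinimiserShells` (stmt-AtomisticToContinuum-9225): the COARSE / COARSE-TO-FINE split

Route `PalmUnimodularRigidity`, crux decl
`Summit.AtomisticToContinuum.Crystallization.Theses.PalmUnimodularRigidity.MinimiserShells`
(strategist seat `cstrat-stmt-AtomisticToContinuum-9225-p1`, 2026-08-17).

The landed sandwich (`Residual.minimiserShells_sandwich`, p121752 / p123347) pins the crux between
`Residual.ShellGap 0` and every `Residual.ShellGap θ`, `θ ∈ (0, 1/10]` (`ShellGap` monotone in `θ`,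
`Residual.shellGap_mono`).  Eleven lead provers found that every line dies at an energy stub of
`ShellGap`-class.  This file records the one cut of `ShellGap 0` whose second piece needs NO lower bound on the
Lennard-Jones ground-state energy `e*`:

* `CoarseShellGapStmt` — `Residual.ShellGap (1/20)` written out over Literature vocabulary (the COARSE hard-core
  periodic shell gap: tolerance `a/100 + 1/20`, radius `(5/4 − 1/20)·a`).  It is NECESSARY for the crux
  (`coarseShellGap_of_minimiserShells`, from p123347 at `θ = 1/20`) and is the open core (bulk 3-D Lennard-Jones
  crystallization in coarse first-shell form, Blanc–Lewin 2015 §2.3).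
* `CoarseToFineShellGapStmt` — the COARSE-TO-FINE (elastic-regime) gap: for every `t > 0` there are `s > 0` and
  `κ > 0` such that a `1/3`-separated periodic `Q` with at least `t·#motif` FINELY bad sites (the crux's own shell
  test: tolerance `a/100`, radius `5a/4`) but fewer than `s·#motif` COARSELY bad sites has `e(Q) ≥ e* + κ`.  Its
  binding competitors are coarsely close-packed everywhere off a sparse set, so `e*` enters only through
  `e* ≤ e(periodic reference)`: the content is coercivity of the LJ energy around the relaxed Barlow stackings
  (atomistic nonlinear elasticity), not a landscape bound.

Theorems: `coarseShellGapStmt_iff` (`Iff.rfl` against `ShellGap (1/20)`), `shellGap_zero_of_subs`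
(the two pieces give `ShellGap 0`: case split on the coarse-bad fraction at the threshold `s(t)`),
**`minimiserShells_of_subs : CoarseShellGapStmt → CoarseToFineShellGapStmt → MinimiserShells`** (the glue of the
split, via `Residual.minimiserShells_of_shellGap_zero`), `subs_of_shellGap_zero` (the cut is EXACT:
`ShellGap 0 ↔ CoarseShellGapStmt ∧ CoarseToFineShellGapStmt`), `coarseShellGap_of_minimiserShells` (necessity of
piece 1).  `minimiserShells_of_subs'` restates the glue with both hypotheses written out literally (the children's
statement texts), for `route edit --split … --glue-by`.
-/

noncomputable section

open MeasureTheory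
open scoped ENNReal BigOperators Classical

namespace Summit.AtomisticToContinuum.Crystallization.Theorems.PalmUnimodularRigidityMinimiserShells.Split

open Literature.MathematicalPhysics.StatisticalMechanics (lennardJones PeriodicConfiguration)
open Summit.AtomisticToContinuum.Crystallization.Theses.PalmUnimodularRigidity (MinimiserShells)
open Literature.Geometry.DiscreteGeometry (ShellCloseTo fccKissingPattern hcpKissingPattern)
open Summit.AtomisticToContinuum.Crystallization.Theorems.MinimiserShells.Negative.LoadBearing (eStar GoodShell)
open Summit.AtomisticToContinuum.Crystallization.Theorems.PalmUnimodularRigidityMinimiserShells.Residual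
  (ShellGap IsSepThird looseBadMotifCount LooseGoodShell rerooted looseBadMotifCount_zero
   minimiserShells_of_shellGap_zero shellGap_of_minimiserShells shellGap_of_shellGap_zero)

/-- **Piece 1 — the COARSE hard-core periodic shell gap** (`Residual.ShellGap (1/20)` written out; this is the
statement text of the route child `CoarseShellGap`).  For every `t > 0` some `κ > 0` makes every periodic
configuration of `ℝ³` with `1/3`-separated points and at least `t·#motif` motif sites whose shell fails even the
LOOSENED test (tolerance `a/100 + 1/20`, radius `(5/4 − 1/20)·a`, some scale `a ∈ [9/10, 1]`, FCC or HCP pattern)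
have energy per particle `≥ e* + κ`.  OPEN (coarse 3-D Lennard-Jones crystallization in first-shell form);
necessary for the crux (`coarseShellGap_of_minimiserShells`). -/
def CoarseShellGapStmt : Prop :=
  ∀ t : ℝ, 0 < t → ∃ κ : ℝ, 0 < κ ∧
    ∀ Q : Literature.MathematicalPhysics.StatisticalMechanics.PeriodicConfiguration 3,
      (∀ p ∈ Q.points, ∀ q ∈ Q.points, p ≠ q → (1 : ℝ) / 3 ≤ dist p q) →
      t * (Q.motif.card : ℝ) ≤ (Nat.card {x : Q.motif // ¬ (∃ a : ℝ, 9 / 10 ≤ a ∧ a ≤ 1 ∧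
          ∃ T : Finset (EuclideanSpace ℝ (Fin 3)),
          (↑T : Set (EuclideanSpace ℝ (Fin 3))) = {w : EuclideanSpace ℝ (Fin 3) |
            ((MeasureTheory.Measure.count : MeasureTheory.Measure (EuclideanSpace ℝ (Fin 3))).restrict
              ((fun z => z - (x : EuclideanSpace ℝ (Fin 3))) '' Q.points)) {w} ≠ 0 ∧ w ≠ 0 ∧
              ‖w‖ ≤ (5 / 4 - 1 / 20) * a} ∧
          (Literature.Geometry.DiscreteGeometry.ShellCloseTo (a / 100 + 1 / 20) T
            (Finset.image (fun v : EuclideanSpace ℝ (Fin 3) => a • v)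
              Literature.Geometry.DiscreteGeometry.fccKissingPattern) ∨
           Literature.Geometry.DiscreteGeometry.ShellCloseTo (a / 100 + 1 / 20) T
            (Finset.image (fun v : EuclideanSpace ℝ (Fin 3) => a • v)
              Literature.Geometry.DiscreteGeometry.hcpKissingPattern)))} : ℝ) →
      (⨅ P : Literature.MathematicalPhysics.StatisticalMechanics.PeriodicConfiguration 3,
          P.energyPerParticle Literature.MathematicalPhysics.StatisticalMechanics.lennardJones) + κ ≤
        Q.energyPerParticle Literature.MathematicalPhysics.StatisticalMechanics.lennardJones

/-- **Piece 2 — the COARSE-TO-FINE (elastic-regime) gap** (statement text of the route child `CoarseToFineShellGap`).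
For every `t > 0` there are `s > 0` and `κ > 0` such that every periodic configuration of `ℝ³` with
`1/3`-separated points, at least `t·#motif` motif sites failing the crux's own FINE shell test (tolerance `a/100`,
radius `5a/4`) and FEWER than `s·#motif` motif sites failing the LOOSENED test (tolerance `a/100 + 1/20`, radius
`(5/4 − 1/20)·a`) has energy per particle `≥ e* + κ`.  No lower bound on `e*` is involved: the competitors are
coarsely close-packed off a sparse set, and `e* ≤ e(reference stacking)` by definition of the infimum. -/
def CoarseToFineShellGapStmt : Prop :=
  ∀ t : ℝ, 0 < t → ∃ s : ℝ, 0 < s ∧ ∃ κ : ℝ, 0 < κ ∧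
    ∀ Q : Literature.MathematicalPhysics.StatisticalMechanics.PeriodicConfiguration 3,
      (∀ p ∈ Q.points, ∀ q ∈ Q.points, p ≠ q → (1 : ℝ) / 3 ≤ dist p q) →
      t * (Q.motif.card : ℝ) ≤ (Nat.card {x : Q.motif // ¬ (∃ a : ℝ, 9 / 10 ≤ a ∧ a ≤ 1 ∧
          ∃ T : Finset (EuclideanSpace ℝ (Fin 3)),
          (↑T : Set (EuclideanSpace ℝ (Fin 3))) = {y : EuclideanSpace ℝ (Fin 3) |
            ((MeasureTheory.Measure.count : MeasureTheory.Measure (EuclideanSpace ℝ (Fin 3))).restrict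
              ((fun z => z - (x : EuclideanSpace ℝ (Fin 3))) '' Q.points)) {y} ≠ 0 ∧ y ≠ 0 ∧
              ‖y‖ ≤ 5 / 4 * a} ∧
          (Literature.Geometry.DiscreteGeometry.ShellCloseTo (a / 100) T
            (Finset.image (fun v : EuclideanSpace ℝ (Fin 3) => a • v)
              Literature.Geometry.DiscreteGeometry.fccKissingPattern) ∨
           Literature.Geometry.DiscreteGeometry.ShellCloseTo (a / 100) T
            (Finset.image (fun v : EuclideanSpace ℝ (Fin 3) => a • v)
              Literature.Geometry.DiscreteGeometry.hcpKissingPattern)))} : ℝ) →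
      (Nat.card {x : Q.motif // ¬ (∃ a : ℝ, 9 / 10 ≤ a ∧ a ≤ 1 ∧
          ∃ T : Finset (EuclideanSpace ℝ (Fin 3)),
          (↑T : Set (EuclideanSpace ℝ (Fin 3))) = {w : EuclideanSpace ℝ (Fin 3) |
            ((MeasureTheory.Measure.count : MeasureTheory.Measure (EuclideanSpace ℝ (Fin 3))).restrict
              ((fun z => z - (x : EuclideanSpace ℝ (Fin 3))) '' Q.points)) {w} ≠ 0 ∧ w ≠ 0 ∧
              ‖w‖ ≤ (5 / 4 - 1 / 20) * a} ∧
          (Literature.Geometry.DiscreteGeometry.ShellCloseTo (a / 100 + 1 / 20) T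
            (Finset.image (fun v : EuclideanSpace ℝ (Fin 3) => a • v)
              Literature.Geometry.DiscreteGeometry.fccKissingPattern) ∨
           Literature.Geometry.DiscreteGeometry.ShellCloseTo (a / 100 + 1 / 20) T
            (Finset.image (fun v : EuclideanSpace ℝ (Fin 3) => a • v)
              Literature.Geometry.DiscreteGeometry.hcpKissingPattern)))} : ℝ) <
        s * (Q.motif.card : ℝ) →
      (⨅ P : Literature.MathematicalPhysics.StatisticalMechanics.PeriodicConfiguration 3,
          P.energyPerParticle Literature.MathematicalPhysics.StatisticalMechanics.lennardJones) + κ ≤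
        Q.energyPerParticle Literature.MathematicalPhysics.StatisticalMechanics.lennardJones

/-! ## Read-back against the residual vocabulary -/

/-- Piece 1 is, verbatim up to unfolding, `Residual.ShellGap (1/20)`. -/
theorem coarseShellGapStmt_iff : CoarseShellGapStmt ↔ ShellGap (1 / 20) := Iff.rfl

/-- Piece 2 in the residual vocabulary: fine-bad count = `looseBadMotifCount 0`, coarse-bad count =
`looseBadMotifCount (1/20)`. -/
theorem coarseToFineShellGapStmt_iff :
    CoarseToFineShellGapStmt ↔
    (∀ t : ℝ, 0 < t → ∃ s : ℝ, 0 < s ∧ ∃ κ : ℝ, 0 < κ ∧ ∀ Q : PeriodicConfiguration 3, IsSepThird Q →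
      t * (Q.motif.card : ℝ) ≤ (looseBadMotifCount 0 Q : ℝ) →
      (looseBadMotifCount (1 / 20) Q : ℝ) < s * (Q.motif.card : ℝ) →
      eStar + κ ≤ Q.energyPerParticle lennardJones) := by
  simp only [CoarseToFineShellGapStmt, looseBadMotifCount_zero]
  rfl

/-! ## The glue: the two pieces give `ShellGap 0`, hence the crux -/

/-- **The two pieces give the fine hard-core periodic shell gap `ShellGap 0`.**  Given `t`, take `s, κ₂` from
piece 2 and `κ₁` from piece 1 at threshold `s`; a `t`-finely-bad `Q` either has coarse-bad fraction `≥ s`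
(piece 1: gap `κ₁`) or `< s` (piece 2: gap `κ₂`). -/
theorem shellGap_zero_of_subs (h₁ : CoarseShellGapStmt) (h₂ : CoarseToFineShellGapStmt) : ShellGap 0 := by
  rw [coarseShellGapStmt_iff] at h₁
  rw [coarseToFineShellGapStmt_iff] at h₂
  intro t ht
  obtain ⟨s, hs, κ₂, hκ₂, H₂⟩ := h₂ t ht
  obtain ⟨κ₁, hκ₁, H₁⟩ := h₁ s hs
  refine ⟨min κ₁ κ₂, lt_min hκ₁ hκ₂, fun Q hsep hbad => ?_⟩
  by_cases hc : s * (Q.motif.card : ℝ) ≤ (looseBadMotifCount (1 / 20) Q : ℝ)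
  · exact le_trans (add_le_add le_rfl (min_le_left κ₁ κ₂)) (H₁ Q hsep hc)
  · exact le_trans (add_le_add le_rfl (min_le_right κ₁ κ₂)) (H₂ Q hsep hbad (not_le.mp hc))

/-- **GLUE OF THE SPLIT: `CoarseShellGap → CoarseToFineShellGap → MinimiserShells`.** -/
theorem minimiserShells_of_subs : CoarseShellGapStmt → CoarseToFineShellGapStmt → MinimiserShells :=
  fun h₁ h₂ => minimiserShells_of_shellGap_zero (shellGap_zero_of_subs h₁ h₂)

/-! ## The cut is exact, and piece 1 is necessary for the crux -/

/-- `ShellGap 0` gives back both pieces (piece 1 by monotonicity in `θ`, piece 2 by dropping the sparsity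
hypothesis): the split loses nothing relative to the residual. -/
theorem subs_of_shellGap_zero (h : ShellGap 0) : CoarseShellGapStmt ∧ CoarseToFineShellGapStmt := by
  refine ⟨coarseShellGapStmt_iff.2 (shellGap_of_shellGap_zero h (by norm_num) (by norm_num)), ?_⟩
  rw [coarseToFineShellGapStmt_iff]
  intro t ht
  obtain ⟨κ, hκ, H⟩ := h t ht
  exact ⟨1, one_pos, κ, hκ, fun Q hsep hbad _ => H Q hsep hbad⟩

/-- The residual is equivalent to the conjunction of the two pieces. -/
theorem shellGap_zero_iff_subs : ShellGap 0 ↔ CoarseShellGapStmt ∧ CoarseToFineShellGapStmt :=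
  ⟨subs_of_shellGap_zero, fun h => shellGap_zero_of_subs h.1 h.2⟩

/-- **Piece 1 is NECESSARY for the crux** (the sandwich p123347 at `θ = 1/20`): no decomposition of
`MinimiserShells` can avoid the coarse shell gap. -/
theorem coarseShellGap_of_minimiserShells (h : MinimiserShells) : CoarseShellGapStmt :=
  coarseShellGapStmt_iff.2 (shellGap_of_minimiserShells h (by norm_num) (by norm_num))

/-- The glue with both hypotheses written out literally (the statement texts of the route children
`CoarseShellGap` and `CoarseToFineShellGap`), for `ledger route edit --split MinimiserShells --glue-by`. -/
theorem minimiserShells_of_subs' :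
    (∀ t : ℝ, 0 < t → ∃ κ : ℝ, 0 < κ ∧
      ∀ Q : Literature.MathematicalPhysics.StatisticalMechanics.PeriodicConfiguration 3,
        (∀ p ∈ Q.points, ∀ q ∈ Q.points, p ≠ q → (1 : ℝ) / 3 ≤ dist p q) →
        t * (Q.motif.card : ℝ) ≤ (Nat.card {x : Q.motif // ¬ (∃ a : ℝ, 9 / 10 ≤ a ∧ a ≤ 1 ∧
            ∃ T : Finset (EuclideanSpace ℝ (Fin 3)),
            (↑T : Set (EuclideanSpace ℝ (Fin 3))) = {w : EuclideanSpace ℝ (Fin 3) |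
              ((MeasureTheory.Measure.count : MeasureTheory.Measure (EuclideanSpace ℝ (Fin 3))).restrict
                ((fun z => z - (x : EuclideanSpace ℝ (Fin 3))) '' Q.points)) {w} ≠ 0 ∧ w ≠ 0 ∧
                ‖w‖ ≤ (5 / 4 - 1 / 20) * a} ∧
            (Literature.Geometry.DiscreteGeometry.ShellCloseTo (a / 100 + 1 / 20) T
              (Finset.image (fun v : EuclideanSpace ℝ (Fin 3) => a • v)
                Literature.Geometry.DiscreteGeometry.fccKissingPattern) ∨
             Literature.Geometry.DiscreteGeometry.ShellCloseTo (a / 100 + 1 / 20) T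
              (Finset.image (fun v : EuclideanSpace ℝ (Fin 3) => a • v)
                Literature.Geometry.DiscreteGeometry.hcpKissingPattern)))} : ℝ) →
        (⨅ P : Literature.MathematicalPhysics.StatisticalMechanics.PeriodicConfiguration 3,
            P.energyPerParticle Literature.MathematicalPhysics.StatisticalMechanics.lennardJones) + κ ≤
          Q.energyPerParticle Literature.MathematicalPhysics.StatisticalMechanics.lennardJones) →
    (∀ t : ℝ, 0 < t → ∃ s : ℝ, 0 < s ∧ ∃ κ : ℝ, 0 < κ ∧
      ∀ Q : Literature.MathematicalPhysics.StatisticalMechanics.PeriodicConfiguration 3,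
        (∀ p ∈ Q.points, ∀ q ∈ Q.points, p ≠ q → (1 : ℝ) / 3 ≤ dist p q) →
        t * (Q.motif.card : ℝ) ≤ (Nat.card {x : Q.motif // ¬ (∃ a : ℝ, 9 / 10 ≤ a ∧ a ≤ 1 ∧
            ∃ T : Finset (EuclideanSpace ℝ (Fin 3)),
            (↑T : Set (EuclideanSpace ℝ (Fin 3))) = {y : EuclideanSpace ℝ (Fin 3) |
              ((MeasureTheory.Measure.count : MeasureTheory.Measure (EuclideanSpace ℝ (Fin 3))).restrict
                ((fun z => z - (x : EuclideanSpace ℝ (Fin 3))) '' Q.points)) {y} ≠ 0 ∧ y ≠ 0 ∧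
                ‖y‖ ≤ 5 / 4 * a} ∧
            (Literature.Geometry.DiscreteGeometry.ShellCloseTo (a / 100) T
              (Finset.image (fun v : EuclideanSpace ℝ (Fin 3) => a • v)
                Literature.Geometry.DiscreteGeometry.fccKissingPattern) ∨
             Literature.Geometry.DiscreteGeometry.ShellCloseTo (a / 100) T
              (Finset.image (fun v : EuclideanSpace ℝ (Fin 3) => a • v)
                Literature.Geometry.DiscreteGeometry.hcpKissingPattern)))} : ℝ) →
        (Nat.card {x : Q.motif // ¬ (∃ a : ℝ, 9 / 10 ≤ a ∧ a ≤ 1 ∧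
            ∃ T : Finset (EuclideanSpace ℝ (Fin 3)),
            (↑T : Set (EuclideanSpace ℝ (Fin 3))) = {w : EuclideanSpace ℝ (Fin 3) |
              ((MeasureTheory.Measure.count : MeasureTheory.Measure (EuclideanSpace ℝ (Fin 3))).restrict
                ((fun z => z - (x : EuclideanSpace ℝ (Fin 3))) '' Q.points)) {w} ≠ 0 ∧ w ≠ 0 ∧
                ‖w‖ ≤ (5 / 4 - 1 / 20) * a} ∧
            (Literature.Geometry.DiscreteGeometry.ShellCloseTo (a / 100 + 1 / 20) T
              (Finset.image (fun v : EuclideanSpace ℝ (Fin 3) => a • v)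
                Literature.Geometry.DiscreteGeometry.fccKissingPattern) ∨
             Literature.Geometry.DiscreteGeometry.ShellCloseTo (a / 100 + 1 / 20) T
              (Finset.image (fun v : EuclideanSpace ℝ (Fin 3) => a • v)
                Literature.Geometry.DiscreteGeometry.hcpKissingPattern)))} : ℝ) <
          s * (Q.motif.card : ℝ) →
        (⨅ P : Literature.MathematicalPhysics.StatisticalMechanics.PeriodicConfiguration 3,
            P.energyPerParticle Literature.MathematicalPhysics.StatisticalMechanics.lennardJones) + κ ≤
          Q.energyPerParticle Literature.MathematicalPhysics.StatisticalMechanics.lennardJones) →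
    MinimiserShells :=
  minimiserShells_of_subs

end Summit.AtomisticToContinuum.Crystallization.Theorems.PalmUnimodularRigidityMinimiserShells.Split

end
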